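import Summits.HubbardSuperconductivity.HubbardSuperconductivity.Theorems.ThermalWedgeTwSeededEnsembleEquivalenceRSourcedPressureLimit

/-!
# Crux `TwSeededEnsembleEquivalenceR` (stmt-HubbardSuperconductivity-15581), line `cold-floor-collapse` (slug `Sketch`),
# skeleton v8 (block two-phase pinning) — registered stub `stub_blockPressureLimit` (S7b)

Support file (`--supports stmt-HubbardSuperconductivity-15581`; sorry-free; no definition).
Torus and free-boundary square sourced pressures have a common limit.
-/

set_option linter.dupNamespace false

namespace Summit.HubbardSuperconductivity.HubbardSuperconductivity.Theorems.TwSeededEnsembleEquivalenceR.ColdFloorLine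

open Matrix Filter Topology Finset Literature.MathematicalPhysics.QuantumLattice
open Literature.Barriers.HubbardSuperconductivity Literature.Probability.LatticeModels
open scoped ComplexOrder Matrix.Norms.L2Operator

noncomputable section

/-- **S7b `stub_blockPressureLimit` (the torus and the free-boundary square sourced pressures have a COMMON limit).** For all
real `β > 0`, `U`, `μ`, `h` there is ONE `q` such that both the torus pressure `log Re Z_β(dWaveSourceTorus L U μ h)/(βL²)`
(`L → ∞`) and the open-square pressure `log Re Z_β(Rect_M(μ,h))/(βM²)` (`M → ∞`) converge to `q`. This is the S3 proof
(`stub_sourcedPressureLimit`) verbatim, exposing the free-boundary limit `q₀/β` of `twR_rect_logZ_density_tendsto` it passes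
through (`twR_box_partitionFn_eq_rect`, `twR_abs_log_partitionFn_torus_sub_box_le`). Ruelle (1969) §2.2–2.3. [folklore] -/
theorem stub_blockPressureLimit :
    ∀ (β U μ h : ℝ), 0 < β → ∃ q : ℝ,
      (∀ κ : ℝ, 0 < κ → ∃ L₀ : ℕ, ∀ (L : ℕ) [NeZero L], L₀ ≤ L → |Real.log (Matrix.partitionFn β (dWaveSourceTorus L U μ h)).re / (β * (L : ℝ) ^ 2) - q| ≤ κ) ∧
      (∀ κ : ℝ, 0 < κ → ∃ M₀ : ℕ, ∀ (M : ℕ), M₀ ≤ M →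
        |Real.log (Matrix.partitionFn β (hamiltonianWith ((zdGraph 2).comap (fun p : (Lex (Fin M × Fin M)) => ![((ofLex p).1 : ℤ), ((ofLex p).2 : ℤ)])) 1 U μ - (h : ℂ) • ((∑ z : (Lex (Fin M × Fin M)) × (Lex (Fin M × Fin M)), (fun z : (Lex (Fin M × Fin M)) × (Lex (Fin M × Fin M)) => (fun v : Fin 2 → ℤ => ((dWaveFormFactor v / Real.sqrt 2 : ℝ) : ℂ)) (![((ofLex z.2).1 : ℤ), ((ofLex z.2).2 : ℤ)] - ![((ofLex z.1).1 : ℤ), ((ofLex z.1).2 : ℤ)])) z • bondPair z.1 z.2) + (∑ z : (Lex (Fin M × Fin M)) × (Lex (Fin M × Fin M)), (fun z : (Lex (Fin M × Fin M)) × (Lex (Fin M × Fin M)) => (fun v : Fin 2 → ℤ => ((dWaveFormFactor v / Real.sqrt 2 : ℝ) : ℂ)) (![((ofLex z.2).1 : ℤ), ((ofLex z.2).2 : ℤ)] - ![((ofLex z.1).1 : ℤ), ((ofLex z.1).2 : ℤ)])) z • bondPair z.1 z.2)ᴴ))).re / (β * (M : ℝ) ^ 2) - q| ≤ κ) := by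
  intro β U μ h hβ
  obtain ⟨q₀, hq₀⟩ := twR_rect_logZ_density_tendsto (fun v : Fin 2 → ℤ => ((dWaveFormFactor v / Real.sqrt 2 : ℝ) : ℂ)) twR_dWaveKernel_norm_le twR_dWaveKernel_adj hβ.le 1 U μ h
  -- the free-boundary density along all squares
  have hF : Tendsto (fun m : ℕ => Real.log (partitionFn β (hamiltonianWith ((zdGraph 2).comap (fun p : (Lex (Fin m × Fin m)) => ![((ofLex p).1 : ℤ), ((ofLex p).2 : ℤ)])) 1 U μ - (h : ℂ) • ((∑ z : (Lex (Fin m × Fin m)) × (Lex (Fin m × Fin m)), (fun z : (Lex (Fin m × Fin m)) × (Lex (Fin m × Fin m)) => (fun v : Fin 2 → ℤ => ((dWaveFormFactor v / Real.sqrt 2 : ℝ) : ℂ)) (![((ofLex z.2).1 : ℤ), ((ofLex z.2).2 : ℤ)] - ![((ofLex z.1).1 : ℤ), ((ofLex z.1).2 : ℤ)])) z • bondPair z.1 z.2) + (∑ z : (Lex (Fin m × Fin m)) × (Lex (Fin m × Fin m)), (fun z : (Lex (Fin m × Fin m)) × (Lex (Fin m × Fin m)) => (fun v : Fin 2 → ℤ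 => ((dWaveFormFactor v / Real.sqrt 2 : ℝ) : ℂ)) (![((ofLex z.2).1 : ℤ), ((ofLex z.2).2 : ℤ)] - ![((ofLex z.1).1 : ℤ), ((ofLex z.1).2 : ℤ)])) z • bondPair z.1 z.2)ᴴ))).re / ((m : ℕ) : ℝ) ^ 2) atTop (𝓝 q₀) :=
    (tendsto_add_atTop_iff_nat (f := fun m : ℕ => Real.log (partitionFn β (hamiltonianWith ((zdGraph 2).comap (fun p : (Lex (Fin m × Fin m)) => ![((ofLex p).1 : ℤ), ((ofLex p).2 : ℤ)])) 1 U μ - (h : ℂ) • ((∑ z : (Lex (Fin m × Fin m)) × (Lex (Fin m × Fin m)), (fun z : (Lex (Fin m × Fin m)) × (Lex (Fin m × Fin m)) => (fun v : Fin 2 → ℤ => ((dWaveFormFactor v / Real.sqrt 2 : ℝ) : ℂ)) (![((ofLex z.2).1 : ℤ), ((ofLex z.2).2 : ℤ)] - ![((ofLex z.1).1 : ℤ), ((ofLex z.1).2 : ℤ)])) z • bondPair z.1 z.2) + (∑ z : (Lex (Fin m × Fin m)) × (Lex (Fin m × Fin m)), (fun z : (Lex (Fin m × Fin m)) × (Lex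 (Fin m × Fin m)) => (fun v : Fin 2 → ℤ => ((dWaveFormFactor v / Real.sqrt 2 : ℝ) : ℂ)) (![((ofLex z.2).1 : ℤ), ((ofLex z.2).2 : ℤ)] - ![((ofLex z.1).1 : ℤ), ((ofLex z.1).2 : ℤ)])) z • bondPair z.1 z.2)ᴴ))).re / ((m : ℕ) : ℝ) ^ 2) 1).1 hq₀
  refine ⟨q₀ / β, fun κ hκ => ?_, fun κ hκ => ?_⟩
  · -- the total error `(8 + 96|h|)/L + |F L - q₀|/β` tends to zero
    have hG : Tendsto (fun m : ℕ => (8 + 96 * |h|) / ((m : ℕ) : ℝ) + |Real.log (partitionFn β (hamiltonianWith ((zdGraph 2).comap (fun p : (Lex (Fin m × Fin m)) => ![((ofLex p).1 : ℤ), ((ofLex p).2 : ℤ)])) 1 U μ - (h : ℂ) • ((∑ z : (Lex (Fin m × Fin m)) × (Lex (Fin m × Fin m)), (fun z : (Lex (Fin m × Fin m)) × (Lex (Fin m × Fin m)) => (fun v : Fin 2 → ℤ => ((dWaveFormFactor v / Real.sqrt 2 : ℝ) : ℂ)) (![((ofLex z.2).1 : ℤ), ((ofLex z.2).2 : ℤ)]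 - ![((ofLex z.1).1 : ℤ), ((ofLex z.1).2 : ℤ)])) z • bondPair z.1 z.2) + (∑ z : (Lex (Fin m × Fin m)) × (Lex (Fin m × Fin m)), (fun z : (Lex (Fin m × Fin m)) × (Lex (Fin m × Fin m)) => (fun v : Fin 2 → ℤ => ((dWaveFormFactor v / Real.sqrt 2 : ℝ) : ℂ)) (![((ofLex z.2).1 : ℤ), ((ofLex z.2).2 : ℤ)] - ![((ofLex z.1).1 : ℤ), ((ofLex z.1).2 : ℤ)])) z • bondPair z.1 z.2)ᴴ))).re / ((m : ℕ) : ℝ) ^ 2 - q₀| / β) atTop (𝓝 0) := by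
      have h1 : Tendsto (fun m : ℕ => (8 + 96 * |h|) / ((m : ℕ) : ℝ)) atTop (𝓝 0) := tendsto_const_div_atTop_nhds_zero_nat _
      have h2 : Tendsto (fun m : ℕ => |Real.log (partitionFn β (hamiltonianWith ((zdGraph 2).comap (fun p : (Lex (Fin m × Fin m)) => ![((ofLex p).1 : ℤ), ((ofLex p).2 : ℤ)])) 1 U μ - (h : ℂ) • ((∑ z : (Lex (Fin m × Fin m)) × (Lex (Fin m × Fin m)), (fun z : (Lex (Fin m × Fin m)) × (Lex (Fin m × Fin m)) => (fun v : Fin 2 → ℤ => ((dWaveFormFactor v / Real.sqrt 2 : ℝ) : ℂ)) (![((ofLex z.2).1 : ℤ), ((ofLex z.2).2 : ℤ)] - ![((ofLex z.1).1 : ℤ), ((ofLex z.1).2 : ℤ)])) z • bondPair z.1 z.2) + (∑ z : (Lex (Fin m × Fin m)) × (Lex (Fin m × Fin m)), (fun z : (Lex (Fin m × Fin m)) × (Lex (Fin m × Fin m)) => (fun v : Fin 2 → ℤ => ((dWaveFormFactor v / Real.sqrt 2 : ℝ) : ℂ)) (![((ofLex z.2).1 : ℤ), ((ofLex z.2).2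 : ℤ)] - ![((ofLex z.1).1 : ℤ), ((ofLex z.1).2 : ℤ)])) z • bondPair z.1 z.2)ᴴ))).re / ((m : ℕ) : ℝ) ^ 2 - q₀| / β) atTop (𝓝 0) := by
        have h3 : Tendsto (fun m : ℕ => Real.log (partitionFn β (hamiltonianWith ((zdGraph 2).comap (fun p : (Lex (Fin m × Fin m)) => ![((ofLex p).1 : ℤ), ((ofLex p).2 : ℤ)])) 1 U μ - (h : ℂ) • ((∑ z : (Lex (Fin m × Fin m)) × (Lex (Fin m × Fin m)), (fun z : (Lex (Fin m × Fin m)) × (Lex (Fin m × Fin m)) => (fun v : Fin 2 → ℤ => ((dWaveFormFactor v / Real.sqrt 2 : ℝ) : ℂ)) (![((ofLex z.2).1 : ℤ), ((ofLex z.2).2 : ℤ)] - ![((ofLex z.1).1 : ℤ), ((ofLex z.1).2 : ℤ)])) z • bondPair z.1 z.2) + (∑ z : (Lex (Fin m × Fin m)) × (Lex (Fin m × Fin m)), (fun z : (Lex (Fin m × Fin m)) × (Lex (Fin m × Fin m)) => (fun v : Fin 2 → ℤ => ((dWaveFormFactor v / Real.sqrt 2 : ℝ) : ℂ)) (![((ofLex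 z.2).1 : ℤ), ((ofLex z.2).2 : ℤ)] - ![((ofLex z.1).1 : ℤ), ((ofLex z.1).2 : ℤ)])) z • bondPair z.1 z.2)ᴴ))).re / ((m : ℕ) : ℝ) ^ 2 - q₀) atTop (𝓝 0) := by
          have := hF.sub_const q₀
          rwa [sub_self] at this
        have h4 := (continuous_abs.tendsto 0).comp h3
        rw [Function.comp_def, abs_zero] at h4
        simpa using h4.div_const β
      simpa using h1.add h2
    obtain ⟨N, hN⟩ := Filter.eventually_atTop.1 (hG.eventually (gt_mem_nhds hκ))
    refine ⟨max 3 N, fun L _ hL => ?_⟩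
    have hL3 : 3 ≤ L := le_of_max_le_left hL
    have hLN : N ≤ L := le_of_max_le_right hL
    have hLpos : (0 : ℝ) < L := by exact_mod_cast (show 0 < L by omega)
    have hL2 : (0 : ℝ) < (L : ℝ) ^ 2 := by positivity
    -- torus versus box versus rectangle
    have hbox := twR_abs_log_partitionFn_torus_sub_box_le (L := L) hL3 hβ.le U μ h
    rw [twR_box_partitionFn_eq_rect L β U μ h] at hbox
    set a := Real.log (Matrix.partitionFn β (dWaveSourceTorus L U μ h)).re with ha
    set b := Real.log (partitionFn β (hamiltonianWith ((zdGraph 2).comap (fun p : (Lex (Fin L × Fin L)) => ![((ofLex p).1 : ℤ), ((ofLex p).2 : ℤ)])) 1 U μ - (h : ℂ) • ((∑ z : (Lex (Fin L × Fin L)) × (Lex (Fin L × Fin L)), (fun z : (Lex (Fin L × Fin L)) × (Lex (Fin L × Fin L)) => (fun v : Fin 2 → ℤ => ((dWaveFormFactor v / Real.sqrt 2 : ℝ) : ℂ)) (![((ofLex z.2).1 : ℤ), ((ofLex z.2).2 : ℤ)] - ![((ofLex z.1).1 : ℤ), ((ofLex z.1).2 : ℤ)])) z • bondPair z.1 z.2)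 + (∑ z : (Lex (Fin L × Fin L)) × (Lex (Fin L × Fin L)), (fun z : (Lex (Fin L × Fin L)) × (Lex (Fin L × Fin L)) => (fun v : Fin 2 → ℤ => ((dWaveFormFactor v / Real.sqrt 2 : ℝ) : ℂ)) (![((ofLex z.2).1 : ℤ), ((ofLex z.2).2 : ℤ)] - ![((ofLex z.1).1 : ℤ), ((ofLex z.1).2 : ℤ)])) z • bondPair z.1 z.2)ᴴ))).re with hb
    have hGL := hN L hLN
    -- `|a/(βL²) - q₀/β| = |a/L² - q₀|/β ≤ (|a - b|/L² + |b/L² - q₀|)/β`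
    have e1 : a / (β * (L : ℝ) ^ 2) - q₀ / β = (a / (L : ℝ) ^ 2 - q₀) / β := by
      field_simp
    have e2 : a / (L : ℝ) ^ 2 - q₀ = (a - b) / (L : ℝ) ^ 2 + (b / (L : ℝ) ^ 2 - q₀) := by
      field_simp
      ring
    rw [e1, abs_div, abs_of_pos hβ, div_le_iff₀ hβ, e2]
    have h1 : |(a - b) / (L : ℝ) ^ 2| ≤ β * (8 + 96 * |h|) / L := by
      rw [abs_div, abs_of_pos hL2, div_le_div_iff₀ hL2 hLpos]
      calc |a - b| * L ≤ β * ((8 + 96 * |h|) * L) * L := mul_le_mul_of_nonneg_right hbox hLpos.le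
        _ = β * (8 + 96 * |h|) * (L : ℝ) ^ 2 := by ring
    have h2 := abs_add_le ((a - b) / (L : ℝ) ^ 2) (b / (L : ℝ) ^ 2 - q₀)
    have h3 : (8 + 96 * |h|) / (L : ℝ) + |b / (L : ℝ) ^ 2 - q₀| / β < κ := hGL
    rw [div_add_div _ _ hLpos.ne' hβ.ne', div_lt_iff₀ (mul_pos hLpos hβ)] at h3
    have h4 : |(a - b) / (L : ℝ) ^ 2| * L ≤ β * (8 + 96 * |h|) := by
      rw [← le_div_iff₀ hLpos]; exact h1
    nlinarith [h1, h2, h3, h4, abs_nonneg ((a - b) / (L : ℝ) ^ 2), abs_nonneg (b / (L : ℝ) ^ 2 - q₀), hLpos, hβ]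
  · -- the open-square conjunct: divide `hF` by `β`
    have hF' : Tendsto (fun m : ℕ => Real.log (partitionFn β (hamiltonianWith ((zdGraph 2).comap (fun p : (Lex (Fin m × Fin m)) => ![((ofLex p).1 : ℤ), ((ofLex p).2 : ℤ)])) 1 U μ - (h : ℂ) • ((∑ z : (Lex (Fin m × Fin m)) × (Lex (Fin m × Fin m)), (fun z : (Lex (Fin m × Fin m)) × (Lex (Fin m × Fin m)) => (fun v : Fin 2 → ℤ => ((dWaveFormFactor v / Real.sqrt 2 : ℝ) : ℂ)) (![((ofLex z.2).1 : ℤ), ((ofLex z.2).2 : ℤ)] - ![((ofLex z.1).1 : ℤ), ((ofLex z.1).2 : ℤ)])) z • bondPair z.1 z.2) + (∑ z : (Lex (Fin m × Fin m)) × (Lex (Fin m × Fin m)), (fun z : (Lex (Fin m × Fin m)) × (Lex (Fin m × Fin m)) => (fun v : Fin 2 → ℤ => ((dWaveFormFactor v / Real.sqrt 2 : ℝ) : ℂ)) (![((ofLex z.2).1 : ℤ), ((ofLex z.2).2 : ℤ)] - ![((ofLex z.1).1 : ℤ), ((ofLex z.1).2 : ℤ)])) z • bondPair z.1 z.2)ᴴ))).re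 / ((m : ℕ) : ℝ) ^ 2 / β) atTop (𝓝 (q₀ / β)) :=
      hF.div_const β
    have hG : Tendsto (fun m : ℕ => Real.log (partitionFn β (hamiltonianWith ((zdGraph 2).comap (fun p : (Lex (Fin m × Fin m)) => ![((ofLex p).1 : ℤ), ((ofLex p).2 : ℤ)])) 1 U μ - (h : ℂ) • ((∑ z : (Lex (Fin m × Fin m)) × (Lex (Fin m × Fin m)), (fun z : (Lex (Fin m × Fin m)) × (Lex (Fin m × Fin m)) => (fun v : Fin 2 → ℤ => ((dWaveFormFactor v / Real.sqrt 2 : ℝ) : ℂ)) (![((ofLex z.2).1 : ℤ), ((ofLex z.2).2 : ℤ)] - ![((ofLex z.1).1 : ℤ), ((ofLex z.1).2 : ℤ)])) z • bondPair z.1 z.2) + (∑ z : (Lex (Fin m × Fin m)) × (Lex (Fin m × Fin m)), (fun z : (Lex (Fin m × Fin m)) × (Lex (Fin m × Fin m)) => (fun v : Fin 2 → ℤ => ((dWaveFormFactor v / Real.sqrt 2 : ℝ) : ℂ)) (![((ofLex z.2).1 : ℤ), ((ofLex z.2).2 : ℤ)] - ![((ofLex z.1).1 : ℤ), ((ofLex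 z.1).2 : ℤ)])) z • bondPair z.1 z.2)ᴴ))).re / ((m : ℕ) : ℝ) ^ 2 / β - q₀ / β) atTop (𝓝 0) := by
      have := hF'.sub_const (q₀ / β)
      rwa [sub_self] at this
    have hA := (continuous_abs.tendsto 0).comp hG
    rw [Function.comp_def, abs_zero] at hA
    obtain ⟨N, hN⟩ := Filter.eventually_atTop.1 (hA.eventually (Iio_mem_nhds hκ))
    refine ⟨N, fun M hM => ?_⟩
    have h1 := hN M hM
    have e : Real.log (partitionFn β (hamiltonianWith ((zdGraph 2).comap (fun p : (Lex (Fin M × Fin M)) => ![((ofLex p).1 : ℤ), ((ofLex p).2 : ℤ)])) 1 U μ - (h : ℂ) • ((∑ z : (Lex (Fin M × Fin M)) × (Lex (Fin M × Fin M)), (fun z : (Lex (Fin M × Fin M)) × (Lex (Fin M × Fin M)) => (fun v : Fin 2 → ℤ => ((dWaveFormFactor v / Real.sqrt 2 : ℝ) : ℂ)) (![((ofLex z.2).1 : ℤ), ((ofLex z.2).2 : ℤ)] - ![((ofLex z.1).1 : ℤ), ((ofLex z.1).2 : ℤ)])) z • bondPair z.1 z.2) + (∑ z : (Lex (Fin M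 × Fin M)) × (Lex (Fin M × Fin M)), (fun z : (Lex (Fin M × Fin M)) × (Lex (Fin M × Fin M)) => (fun v : Fin 2 → ℤ => ((dWaveFormFactor v / Real.sqrt 2 : ℝ) : ℂ)) (![((ofLex z.2).1 : ℤ), ((ofLex z.2).2 : ℤ)] - ![((ofLex z.1).1 : ℤ), ((ofLex z.1).2 : ℤ)])) z • bondPair z.1 z.2)ᴴ))).re / (β * (M : ℝ) ^ 2) =
        Real.log (partitionFn β (hamiltonianWith ((zdGraph 2).comap (fun p : (Lex (Fin M × Fin M)) => ![((ofLex p).1 : ℤ), ((ofLex p).2 : ℤ)])) 1 U μ - (h : ℂ) • ((∑ z : (Lex (Fin M × Fin M)) × (Lex (Fin M × Fin M)), (fun z : (Lex (Fin M × Fin M)) × (Lex (Fin M × Fin M)) => (fun v : Fin 2 → ℤ => ((dWaveFormFactor v / Real.sqrt 2 : ℝ) : ℂ)) (![((ofLex z.2).1 : ℤ), ((ofLex z.2).2 : ℤ)] - ![((ofLex z.1).1 : ℤ), ((ofLex z.1).2 : ℤ)])) z • bondPair z.1 z.2) + (∑ z : (Lex (Fin M × Fin M)) × (Lex (Fin M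 × Fin M)), (fun z : (Lex (Fin M × Fin M)) × (Lex (Fin M × Fin M)) => (fun v : Fin 2 → ℤ => ((dWaveFormFactor v / Real.sqrt 2 : ℝ) : ℂ)) (![((ofLex z.2).1 : ℤ), ((ofLex z.2).2 : ℤ)] - ![((ofLex z.1).1 : ℤ), ((ofLex z.1).2 : ℤ)])) z • bondPair z.1 z.2)ᴴ))).re / ((M : ℕ) : ℝ) ^ 2 / β := by
      rw [div_div, mul_comm]
    rw [e]
    exact h1.le


end

end Summit.HubbardSuperconductivity.HubbardSuperconductivity.Theorems.TwSeededEnsembleEquivalenceR.ColdFloorLine
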